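import Summits.HubbardSuperconductivity.HubbardSuperconductivity.Theorems.AnisotropyChordTransferFibre3KT1Targets
import Summits.HubbardSuperconductivity.HubbardSuperconductivity.Theorems.AnisotropyChordTransferFibre3PairSplit

/-!
# Route `AnisotropyChord` / H0 rotor rung: the `K = 0` cross term `C0` — `C0Explicit` and `C0PrimePythagoras` (PartN33) PROVED

PartN33 = `…Fibre3KT1Targets` (theory seat `hubbard-h0-rotor-theory-1`, memo 21 §297/§307), the two structural facts about
`C0 := 1_{Dᶜ}((H⁰ − ΔW) − 3λ₂)Π⁰` that the (KT-2b) N-term (`‖N‖² ≤ 9‖C0′‖²`, `…KT2bSupports`) and the (KT-1) cross term `B_C` consume: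
* **`c0Explicit_holds (Δ) : C0Explicit L Δ`** — the product rule `xy − x′y′ = x(y−y′) + y(x−x′) − (x−x′)(y−y′)` on the three
  hop families of `H⁰Π⁰` plus the two-magnon equation of each pair factor (`a, b, b−a ≠ 0` off `D`) leaves exactly the 12 second-order
  terms `−½Σ_e[f(c)D_ef(a)D_ef(b) + f(b)D_{−e}f(a)D_ef(c) + f(a)D_ef(b)D_ef(c)]` (the `3λ₂Π⁰` and `ΔWΠ⁰` are the first-order parts);
* **`c0PrimePythagoras_holds (Δ) : C0PrimePythagoras L Δ`** — `⟨Π⁰, C0⟩ = (T⁺ − 3λ₂)‖Π⁰‖²` by the definition of `T⁺`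
  (`sum_piR_C0fn`), hence `‖C0 − (T⁺−3λ₂)Π⁰‖² = ‖C0‖² − (T⁺−3λ₂)²‖Π⁰‖²`.
Prover seat `hubbard-h0-rotor-p1` g22; helper for stmt-HubbardSuperconductivity-19089 (`--supports`).
-/

set_option linter.dupNamespace false
set_option autoImplicit false

noncomputable section

open scoped BigOperators
open Complex

namespace Summit.HubbardSuperconductivity.HubbardSuperconductivity.Theorems.AnisotropyChord.Transfer.Fibre3

variable (L : ℕ) [NeZero L]

/-! ## `H Π⁰` at `K = 0` is real and explicit -/

/-- the real hop triple of direction `e`: `Π⁰(a+e,b) + Π⁰(a,b+e) + Π⁰(a−e,b−e)`. [folklore] -/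
def hopR (f : Tor L → ℝ) (c : Cfg L) (e : Tor L) : ℝ :=
  piR L f (c.1 + e, c.2) + piR L f (c.1, c.2 + e) + piR L f (c.1 - e, c.2 - e)

omit [NeZero L] in
/-- `Π⁰ = (piR : ℂ)`. [folklore] -/
theorem prodState_eq_piR (f : Tor L → ℝ) (c : Cfg L) : prodState L f c = ((piR L f c : ℝ) : ℂ) := rfl

/-- `(H⁰ − ΔW)Π⁰` at `K = 0`, explicitly and as a real number. [folklore] -/
theorem Happly_zero_prodState (Δ : ℝ) (f : Tor L → ℝ) (c : Cfg L) :
    Happly L 0 Δ (prodState L f) c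
      = (((6 * piR L f c
          - (1 / 2) * (hopR L f c (ex L) + hopR L f c (-ex L) + hopR L f c (ey L) + hopR L f c (-ey L))
          - Δ * (Wcount L c : ℝ) * piR L f c) : ℝ) : ℂ) := by
  rw [Happly_four]
  simp only [hopT, hopR, phase_zero_left, one_mul, prodState_eq_piR]
  push_cast
  ring

/-- the real part. [folklore] -/
theorem Happly_zero_prodState_re (Δ : ℝ) (f : Tor L → ℝ) (c : Cfg L) :
    (Happly L 0 Δ (prodState L f) c).re
      = 6 * piR L f c
          - (1 / 2) * (hopR L f c (ex L) + hopR L f c (-ex L) + hopR L f c (ey L) + hopR L f c (-ey L))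
          - Δ * (Wcount L c : ℝ) * piR L f c := by
  rw [Happly_zero_prodState, Complex.ofReal_re]

/-! ## `C0Explicit` -/

/-- ★ **`C0Explicit L Δ` holds.** [folklore] -/
theorem c0Explicit_holds (Δ : ℝ) : C0Explicit L Δ := by
  intro lam2 f hf c hc
  obtain ⟨-, -, -, -, heq⟩ := hf
  -- `c ∉ D`: `a, b, b − a ≠ 0`
  have hc' := hc
  unfold InD at hc'
  simp only [Bool.or_eq_false_iff, decide_eq_false_iff_not] at hc'
  obtain ⟨⟨ha, hb⟩, hab⟩ := hc'
  have hcc : c.2 - c.1 ≠ 0 := sub_ne_zero.mpr (fun h => hab h.symm)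
  -- the three pair equations
  have ea := heq c.1 ha
  have eb := heq c.2 hb
  have ec := heq (c.2 - c.1) hcc
  rw [nnList_map_sum] at ea eb ec
  unfold C0fn
  simp only [hc, Bool.false_eq_true, if_false]
  rw [Happly_zero_prodState_re, nnList_map_sum]
  unfold hopR piR Dgrad Wcount
  push_cast
  -- canonical arguments
  have k1 : f (c.2 - (c.1 + ex L)) = f (c.2 - c.1 - ex L) := congrArg f (by abel)
  have k2 : f (c.2 + ex L - c.1) = f (c.2 - c.1 + ex L) := congrArg f (by abel)
  have k3 : f (c.2 - ex L - (c.1 - ex L)) = f (c.2 - c.1) := congrArg f (by abel)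
  have k4 : f (c.2 - (c.1 - ex L)) = f (c.2 - c.1 + ex L) := congrArg f (by abel)
  have k5 : f (c.2 - ex L - c.1) = f (c.2 - c.1 - ex L) := congrArg f (by abel)
  have k6 : f (c.2 + ex L - (c.1 + ex L)) = f (c.2 - c.1) := congrArg f (by abel)
  have k7 : f (c.2 - (c.1 + ey L)) = f (c.2 - c.1 - ey L) := congrArg f (by abel)
  have k8 : f (c.2 + ey L - c.1) = f (c.2 - c.1 + ey L) := congrArg f (by abel)
  have k9 : f (c.2 - ey L - (c.1 - ey L)) = f (c.2 - c.1) := congrArg f (by abel)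
  have k10 : f (c.2 - (c.1 - ey L)) = f (c.2 - c.1 + ey L) := congrArg f (by abel)
  have k11 : f (c.2 - ey L - c.1) = f (c.2 - c.1 - ey L) := congrArg f (by abel)
  have k12 : f (c.2 + ey L - (c.1 + ey L)) = f (c.2 - c.1) := congrArg f (by abel)
  simp only [sub_neg_eq_add, neg_neg, ← sub_eq_add_neg, k1, k2, k3, k4, k5, k6, k7, k8, k9, k10, k11, k12] at ea eb ec ⊢
  linear_combination (f c.1 * f (c.2 - c.1)) * eb + (f c.1 * f c.2) * ec + (f c.2 * f (c.2 - c.1)) * ea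

/-! ## `C0PrimePythagoras` -/

omit [NeZero L] in
/-- `Π⁰` vanishes on the hard core (`f(0) = 0`). [folklore] -/
theorem piR_D {f : Tor L → ℝ} (h0 : f 0 = 0) (c : Cfg L) (hc : InD L c = true) : piR L f c = 0 := by
  unfold piR
  unfold InD at hc
  simp only [Bool.or_eq_true, decide_eq_true_eq] at hc
  rcases hc with (h | h) | h
  · rw [h, h0]; simp
  · rw [h, h0]; simp
  · rw [h, sub_self, h0]; simp

/-- `‖Π⁰‖² = Re⟨Π⁰, Π⁰⟩`. [folklore] -/
theorem PiNormSq_eq_ip (f : Tor L → ℝ) : PiNormSq L f = (ip L (prodState L f) (prodState L f)).re := by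
  unfold ip PiNormSq
  rw [Complex.re_sum]
  refine Finset.sum_congr rfl fun c _ => ?_
  rw [prodState_eq_piR, Complex.conj_ofReal, ← Complex.ofReal_mul, Complex.ofReal_re]
  ring

/-- `Re⟨Π⁰, HΠ⁰⟩ = Σ Π⁰·(HΠ⁰).re`. [folklore] -/
theorem re_ip_prodState_Happly (Δ : ℝ) (f : Tor L → ℝ) :
    (ip L (prodState L f) (Happly L 0 Δ (prodState L f))).re
      = ∑ c : Cfg L, piR L f c * (Happly L 0 Δ (prodState L f) c).re := by
  unfold ip
  rw [Complex.re_sum]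
  refine Finset.sum_congr rfl fun c _ => ?_
  rw [prodState_eq_piR, Complex.conj_ofReal, Complex.re_ofReal_mul]

/-- **`⟨Π⁰, C0⟩ = (T⁺ − 3λ₂)‖Π⁰‖²`** (definition of `T⁺`; also when `Π⁰ ≡ 0`). [folklore] -/
theorem sum_piR_C0fn {Δ lam2 : ℝ} {f : Tor L → ℝ} (hf : IsTwoMagnon L Δ lam2 f) :
    ∑ c : Cfg L, piR L f c * C0fn L Δ lam2 f c = (Tplus L Δ f - 3 * lam2) * PiNormSq L f := by
  have h0 : f 0 = 0 := hf.1
  have h1 : ∀ c : Cfg L, piR L f c * C0fn L Δ lam2 f c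
      = piR L f c * (Happly L 0 Δ (prodState L f) c).re - 3 * lam2 * piR L f c ^ 2 := by
    intro c
    unfold C0fn
    split_ifs with hc
    · rw [piR_D L h0 c hc]; ring
    · ring
  rw [Finset.sum_congr rfl fun c _ => h1 c, Finset.sum_sub_distrib, ← Finset.mul_sum, ← re_ip_prodState_Happly]
  have hP : PiNormSq L f = ∑ c : Cfg L, piR L f c ^ 2 := rfl
  -- `T⁺ ‖Π‖² = Re⟨Π, HΠ⟩`
  have h4 : Tplus L Δ f * PiNormSq L f = (ip L (prodState L f) (Happly L 0 Δ (prodState L f))).re := by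
    unfold Tplus RQ
    rw [← PiNormSq_eq_ip]
    by_cases hz : PiNormSq L f = 0
    · -- then `Π⁰ ≡ 0`
      have hpi : ∀ c : Cfg L, piR L f c = 0 := by
        intro c
        have h := (Finset.sum_eq_zero_iff_of_nonneg (fun x _ => sq_nonneg (piR L f x))).mp (hP ▸ hz) c (Finset.mem_univ c)
        exact pow_eq_zero_iff (two_ne_zero) |>.mp h
      rw [hz, mul_zero, re_ip_prodState_Happly]
      symm
      exact Finset.sum_eq_zero fun c _ => by rw [hpi c, zero_mul]
    · field_simp
  rw [← hP, ← h4]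
  ring

/-- ★ **`C0PrimePythagoras L Δ` holds.** [folklore] -/
theorem c0PrimePythagoras_holds (Δ : ℝ) : C0PrimePythagoras L Δ := by
  intro lam2 f hf
  have h := sum_piR_C0fn L hf
  unfold nC0
  have hP : PiNormSq L f = ∑ c : Cfg L, piR L f c ^ 2 := rfl
  have hpt : ∀ c : Cfg L, (C0fn L Δ lam2 f c - (Tplus L Δ f - 3 * lam2) * piR L f c) ^ 2
      = C0fn L Δ lam2 f c ^ 2 - 2 * (Tplus L Δ f - 3 * lam2) * (piR L f c * C0fn L Δ lam2 f c)
        + (Tplus L Δ f - 3 * lam2) ^ 2 * piR L f c ^ 2 := by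
    intro c; ring
  rw [Finset.sum_congr rfl fun c _ => hpt c, Finset.sum_add_distrib, Finset.sum_sub_distrib, ← Finset.mul_sum,
    ← Finset.mul_sum, h, ← hP]
  ring

end Summit.HubbardSuperconductivity.HubbardSuperconductivity.Theorems.AnisotropyChord.Transfer.Fibre3

end
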